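import Mathlib
import HarnessLib
import Summits.Parity.GeneralizedHardyLittlewood.Theses.SiegelSpectrumSplit
import Literature.NumberTheory.Sieve.HardyLittlewood
import Literature.NumberTheory.Sieve.ParityWave0

/-!
# `FixedLower` — qualitative core: definitions (decomp-parity trap T21 «qualitative-notch normal form»)

Vocabulary for `Theorems/FixedLowerQualitativeCore.lean`, the structure theorem for the family of
«qualitative notches» beneath the record leaf `SiegelSpectrumSplit.FixedLower` (stmt-Parity-26863, the
fixed-pattern LOWER half of Green–Tao's generalised Hardy–Littlewood conjecture) adopted by the
decomp-parity critic as STANDING TRAP T21 (HOME/STATUS.md l.417, CRITIC-LEDGER row 80; lens-2 g8 kernel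
`HOME/decomp-parity-lens-2/g8/QualitativeCoreFloor.lean` @6dfa93032bcaf2cd):

* `QuantLift`      — the ONE shared quantitative residual `DicksonConjecture → FixedLower`;
* `TupleChebyshev` — the Chebyshev-ORDER lower bound for every fixed non-degenerate affine system, with a
                     constant allowed to depend on the system (second-layer coordinate);
* `OrderLift` / `AsymptoticLift` — the two factors of `QuantLift` through `TupleChebyshev`.

Definitions only; no statements. `DicksonConjecture` is the tree's `Literature.NumberTheory.Sieve.DicksonConjecture`
(parity.S07) and is used BY NAME, not aliased.
-/

open Literature.NumberTheory.Sieve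

namespace Summit.Parity.GeneralizedHardyLittlewood.QualitativeCore

open Summit.Parity.GeneralizedHardyLittlewood.Theses.SiegelSpectrumSplit (FixedLower)

/-- The shared quantitative residual of every qualitative notch beneath `FixedLower`: prime `k`-tuples
for every admissible linear family, qualitatively (Dickson), lift to the fixed-pattern Hardy–Littlewood
lower half (stmt-Parity-26863, BY NAME). (ref. Dickson1904, p. 155; GreenTao2010, Conj. 1.2) -/
def QuantLift : Prop := DicksonConjecture → FixedLower

/-- Second-layer coordinate: the Chebyshev-ORDER lower bound for every fixed non-degenerate affine
system, `c(Ψ)·β_∞∏β_p − Σ ≤ εN^d` eventually, with a constant `c(Ψ) > 0` ALLOWED TO DEPEND ON THE SYSTEM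
(the uniform-constant variant self-improves to `FixedLower` by the tensor-power trick and is deliberately
not typed). Its pair face is the hub target `TwinLowerDensity` (stmt-Parity-18377) up to the Λ ↔ π₂
dictionary. (ref. GreenTao2010, Conj. 1.2 (lower half, order of magnitude)) -/
def TupleChebyshev : Prop :=
  ∀ (d t : ℕ), 1 ≤ d → 1 ≤ t → ∀ Ψ : Fin t → AffLinForm d, IsNondegenerateSystem Ψ →
    ∃ c : ℝ, 0 < c ∧ ∀ ε : ℝ, 0 < ε → ∃ N₀ : ℕ, ∀ N : ℕ, N₀ ≤ N → ∀ K : Set (Fin d → ℝ), Convex ℝ K →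
      K ⊆ realBox d N → c * (archFactor Ψ K * singularProduct Ψ) - vonMangoldtSum Ψ K N ≤ ε * (N : ℝ) ^ d

/-- Second layer, lower factor: qualitative ⟹ order of magnitude. (ref. GreenTao2010, Conj. 1.2) -/
def OrderLift : Prop := DicksonConjecture → TupleChebyshev

/-- Second layer, upper factor: order of magnitude ⟹ asymptotic lower half. (ref. GreenTao2010, Conj. 1.2) -/
def AsymptoticLift : Prop := TupleChebyshev → FixedLower

end Summit.Parity.GeneralizedHardyLittlewood.QualitativeCore
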